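import Mathlib
import HarnessLib
import Summits.AtomisticToContinuum.FouriersLaw.Theses.JunctionLocality
import Literature.MathematicalPhysics.KineticTheory.LangevinChainGibbs
import Summits.AtomisticToContinuum.FouriersLaw.Theorems.JunctionLocalitySuperadditiveResistanceStubInsertionIdentity
import Summits.AtomisticToContinuum.FouriersLaw.Theorems.JunctionLocalitySuperadditiveResistanceFarTransmissionHelpers
import Summits.AtomisticToContinuum.FouriersLaw.Theorems.JunctionLocalityInsertionCore
import Summits.AtomisticToContinuum.FouriersLaw.Theorems.JunctionLocalitySuperadditiveResistanceKuboFrame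
import Summits.AtomisticToContinuum.FouriersLaw.Theorems.JunctionLocalitySuperadditiveResistanceStubLinearResponsePlain
import Summits.AtomisticToContinuum.FouriersLaw.Theorems.JunctionLocalitySuperadditiveResistanceStubJunctionCurvature
import Summits.AtomisticToContinuum.FouriersLaw.Theorems.JunctionLocalitySuperadditiveResistanceRoughnessSplit

/-!
# Line `thermalise-then-cut-probe-insertion` — checked skeleton for the crux
`JunctionLocality.SuperadditiveResistance` (stmt-AtomisticToContinuum-11748)

Crux (A): along the unique weak-NESS family of `pinnedChain ω₂ lam β γ` (all `> 0`), `T > 0`,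
response coefficients `D_N > 0`: `∃ C ∀ N M ≥ 2, R_N + R_M − C ≤ R_{N+M}`, `R_N := (N−1)/D_N`.
Write `G_L := D_L/(L−1)` (two-terminal conductance), `L = N + M`.

ARCHITECTURE (idea card + triage synthesis "one dissipative-junction device line"). For the split
`(N, M)` the DEVICE is the `(N+M)`-chain with its junction bond `(N−1, N)` KEPT and two extra
Langevin thermostats of the chain's own strength `γ` on the junction momenta `p_{N−1}, p_N`
(terminals `1,2,3,4` = baths on sites `0, N−1, N, N+M−1`). Everything about the device enters
through its EQUILIBRIUM four-terminal linear response at temperature `T`: the symmetric Onsager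
conductances `g a b` (`a ≠ b`), whose quadratic form `Σ g_ab (θ_a − θ_b)²` is the entropy
production (≥ 0). With `u := g₀₁ + g₀₂`, `v := g₁₃ + g₂₃` (junction ↔ end-bath transfers),
`x := g₀₃` (bypass), `a := u + x = L₁₁`, `b := v + x = L₄₄` (end-bath self-conductances), the
merged probe pair FLOATS at first-order temperature `θᶠ := (u − v)/(2(u+v))` and the floating
device conductance is `G_dev := x + u(1/2 − θᶠ) = x + uv/(u+v)`.

* α-LEG (this card's lever, floating form — answers triage objections on `N ≠ M`): for EVERY
  common probe temperature `θ`, the flux out of bath 1 per unit bias, `𝒢₁(θ) = x + u(1/2 − θ)`,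
  satisfies the EXACT insertion identity
  `𝒢₁(θ) − G_L = −γ² ⟨S_K ḡ₁, (I − Π_K)(h − θ·e_K)⟩_{μ_T}`,
  `h` = first-order NESS density of the PLAIN chain (weak solution of `L_T† h = −W`),
  `ḡ₁ = (−L_dev)⁻¹(p_0² − T)` the DEVICE's forward field of the bath-1 energy observable,
  `S_K` = OU operator of the probe pair, `Π_K` = conditional expectation over the two junction
  momenta, `e_K = (p²_{N−1} + p²_N)/(2T²)` (the floating source `θ(W₂ + W₃) = −θγ S_K e_K` is what
  turns the clamped identity (★) of the card into this one). Cauchy–Schwarz, from BOTH ends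
  (`ḡ₄`, flux into bath 4), at `θ = θᶠ` where both sides equal `G_dev`:
  `|G_dev − G_L| ≤ γ² · min(‖S_Kḡ₁‖, ‖S_Kḡ₄‖) · v_K(h − θᶠ e_K)^{1/2}`.
  Bets: `stub_junctionRoughness` (`v_K(h − θᶠe_K) ≤ C₂ G_L²`: junction roughness modulo the
  local-equilibrium shift at the probes' floating temperature — HARDEST) and
  `stub_junctionCurvature` (`‖S_Kḡ₁‖² ≤ C₃ a²`, `‖S_Kḡ₄‖² ≤ C₃ b²`: derivatives only on the
  probed field, at γ-noised coordinates, normalised by the device's own self-conductances).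
* β-LEG (companion card double-escape-termination-locality, imported as two stubs): Dirichlet
  principle `G_dev ≤ u(1/2−θ)² + v(1/2+θ)² + x` (proved here from the second law) + the
  ONE-SIDED bets `stub_terminationLocalityTC` (`a ≤ G_N(1 + cG_N)`, `b ≤ G_M(1 + cG_M)`) and
  `stub_farTransmission` (`0 ≤ x ≤ c G_N G_M`).
* FIXED-N PACKAGE `stub_linearResponse` (existence/uniqueness of the response fields and of the
  device's four-terminal response with its Kubo formulas) and the exact `stub_insertionIdentity`.
* COMPOSITION `SuperadditiveResistance_of` (PROVED, pure real analysis `core_estimate`): with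
  `m := min(a,b)`, `K := γ²√(C₂C₃)`: `G_L(1 − Km) ≤ G_dev ≤ U := (aB² + bA² + 2xAB)/(A+B)²`
  (`A := G_N(1+cG_N)`, `B := G_M(1+cG_M)`, trial node temperature `(A−B)/(2(A+B))`), `U ≥ m/2`
  (uses `x ≥ 0`), hence `R_L ≥ 1/U − 2K ≥ R_N + R_M − 4c − 2K` when `Km ≤ 1/2`, and
  `R_N + R_M ≤ 4K(1+c) + 2` otherwise. NO sign of `u, v`, no M-matrix property, no monotonicity in
  the length and no comparison of `N` with `M` is used: the better of the two ends is selected by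
  `min(a, b)` and paid for by the Dirichlet value `U ≥ m/2`.

Disproof.lean (cdisprove seat, evidence 20260815T224245Z; file not mounted in this seat, used via
its evidence notes): §1 `WithoutDynamics` shell FALSE — honoured: all content sits in the six
dynamical stubs, the composition is pure algebra over their outputs; §3 harmonic-corner tightness
(`C ≥ 1/fluxLimit`) — consistent: every bet is RELATIVE (`O(G²)` in conductance), so at
`lam = β = 0` (outside the crux's box anyway) the skeleton yields an `O(1)` constant, never `C → 0`;
§2/§2b doubling-defect kill statistic and §4(iii) `lam = 0` log edge — the bets
`stub_junctionRoughness`/`stub_terminationLocalityTC` are exactly where bounded mean free path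
(pinning, `lam, β > 0`) must enter. No `_false_without_` theorem names a hypothesis H beyond "the
dynamics"; no landed `Negative/` lemma exists for this crux (`ledger negatives`: none on this decl).

SKELETON v2 (lead prover-line-stmt-AtomisticToContinuum-11748-0, 2026-08-16, after wave 1): the whole device
vocabulary (kin … CruxFrame, Onsager algebra, Dirichlet principle) and the PROVED `stub_insertionIdentity`
(p90116) are now IMPORTED from `Theorems/JunctionLocalitySuperadditiveResistanceStubInsertionIdentity.lean`
(+ `…ThermoIBP.lean` for `thermo`/`junctionOU`); `stub_farTransmission` lost its sign clause `0 ≤ bypass g`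
(worker verdict stub-misstated: not implied by the PSD form — landed `FarTransmission.exists_psd_transfer_neg` —
an open DEP-type conjecture, and numerically false in the resonant-triad class) and the composition now runs on the
landed `FarTransmission.core_estimate_unsigned` (p74848; constant `4c + 4K + 4K(1+c) + 2`); `stub_linearResponse` is
split into its plain and device halves; `stub_terminationLocalityTC` / `stub_farTransmission` additionally receive the
pieces' plain Kubo frames (`∀ L ≥ 2, ∃ h, PlainFrame … (D L/(L−1))`, the output of `stub_linearResponsePlain`) so that
a prover has a Kubo handle on `D N`, `D M` (wave-1 wiring caveat). Stubs: stub_linearResponsePlain,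
stub_linearResponseDevice, stub_insertionIdentity (CLOSED, imported), stub_junctionRoughness (hardest),
stub_junctionCurvature, stub_terminationLocalityTC, stub_farTransmission.

SKELETON v3 (same day): the DEVICE FRAME IS REPLACED BY THE EQUILIBRIUM KUBO FRAME `KuboFrame` = DeviceFrame minus its
clauses (i) device-NESS existence, (ii) device-NESS uniqueness and (v) "g is the response of the four powers along every
device family" — none of which is consumed by the composition or by `insertion_core` (the landed engine of
`stub_insertionIdentity`): what the proof uses is the symmetric PSD matrix `g`, the two END-bath forward fields with their
pointwise Poisson equations, and the Kubo rows of baths 1 and 4. So `g` is now, by definition of the frame, the KUBO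
matrix of the forward fields (physically the response matrix — Rey-Bellet 2003 Rem 4.4 — but that identification is no
longer a proof obligation of this line), and the fixed-`N` device stub shrinks from "network CEHR existence + device
NessUnique + device Kubo response" (three unvendored facts, wave-1 verdict) to `stub_kuboFrame`: existence of the two
forward fields + Onsager symmetry + non-negativity of the Kubo entropy form — all fixed-`N` EQUILIBRIUM statements of the
kind the two leads' toolkits already prove (forward-field uniqueness `DeviceLiouville.forwardField_unique`, plain
forward fields p82318, device resolvent fields p84214, Kubo–Onsager K-files). `insertionIdentity_of_kuboFrame` below is
the landed `insertion_core` re-wrapped (sorry-free); `kuboFrame_of_deviceFrame` records that v3 only WEAKENS the frame, so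
every v3 analytic stub implies its v2/v1 form. Stubs (v3): stub_linearResponsePlain, stub_kuboFrame,
stub_junctionRoughness (hardest), stub_junctionCurvature, stub_terminationLocalityTC, stub_farTransmission
(+ stub_insertionIdentity CLOSED: landed p90116 over DeviceFrame, re-derived here over KuboFrame).
-/

noncomputable section

open MeasureTheory Filter Topology ProbabilityTheory
open scoped ContDiff NNReal
open Literature.MathematicalPhysics.KineticTheory.HeatConduction

namespace Summit.AtomisticToContinuum.FouriersLaw.Cruxes.SuperadditiveResistance.ThermaliseThenCutProbeInsertion

/-! ## The equilibrium Kubo frame (v3)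

`KuboFrame`, `kuboFrame_of_deviceFrame` and `insertionIdentity_of_kuboFrame` are LANDED
(`Theorems/JunctionLocalitySuperadditiveResistanceKuboFrame.lean`, p91006) and imported above; landed reductions of the
open stubs: `stub_kuboFrame_of_forwardFields` (…StubKuboFrameAux1, p92239: the stub ⇐ existence of the four terminal
forward fields), `linearResponsePlain_of_responseIdentity` (…StubLinearResponsePlainAux2, p92444: the stub ⇐ item
stmt-AtomisticToContinuum-12237 `ResponseIdentity`; existence of the response field itself is PROVED, p92040),
`stub_terminationLocalityTC_left_of_remainderBound` + `terminationIdentity_left/right` (…TerminationIdentity, p93070: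
the stub ⇔ an explicit N-uniform bound on a named Gibbs functional). -/

/-! ## The registered stubs (v4)

SKELETON v4 (lead prover-line-stmt-AtomisticToContinuum-11748-c1-0, 2026-08-16): (i) `stub_linearResponsePlain` CLOSED
(p96604) and imported; (ii) the THERMOMETER is gone: the insertion identity holds for EVERY common probe temperature θ,
and the floating weights eliminate θ exactly — `(u+v)(G_dev − G_L) = v(𝒢₁(θ) − G_L) + u(𝒢₄(θ) − G_L)`
(`alpha_leg_twoEnded_signs`, proved below) — so the roughness bet is stated with `∃ θ` (= (2a) "roughness modulo LTE" of v3,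
a statement about the PLAIN chain only: `stub_junctionRoughnessLTE`) and the price of mixing the two ends is the new
pure sign bet `stub_transferNonneg` (`u, v ≥ 0`; v4.2: the `ρ < 1` bypass margin is DERIVED from `stub_junctionCurvature` via the landed energy-channel floor p102456); the constant becomes
`K' = (2/(1−ρ))·γ²√(C₂⁺C₃⁺)`, `ρ = c₀/(c₀+1)`, `c₀ = γ²√C₃⁺/T`. Stubs (v4.3: STUB 2 split into 2a local Ohm + 2b non-thermal pair roughness, `stub_junctionRoughnessLTE` now derived): stub_kuboFrame (fixed-N), stub_junctionRoughnessLTE (hardest, held by the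
lead), stub_junctionCurvature, stub_transferNonneg, stub_terminationLocalityTC, stub_farTransmission. -/

/-! STUB 0a `stub_linearResponsePlain` — CLOSED (p96604, lead -c1-0, 2026-08-16): imported from
`Theorems/JunctionLocalitySuperadditiveResistanceStubLinearResponsePlain.lean` (ResponseIdentity from the landed
`boundaryKubo_proof` + `boundaryKubo_iff_responseIdentity`; by-products `responseIdentity_proof`,
`finiteResponseOfUnique_proof`, `positiveConductance_proof`). -/

/-- STUB 0b — THE KUBO FRAME EXISTS (fixed-`N`, size M–L; not a bet). For every split `(N, M)`, `N, M ≥ 2`, of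
`pinnedChain ω₂ lam β γ` (all `> 0`) at `T > 0` there are END-bath forward fields `gb₁, gb₄` of the equilibrium device
(`C²`, mean zero, `gb`, `S_K gb ∈ L²(μ_T)`, `L_dev gb = −(p_s² − T)` pointwise; resolvent/semigroup theory of the
γ-probed device, cf. the device resolvent fields of the sibling line, p84214) and a symmetric matrix `g` with
non-negative entropy form carrying their Kubo rows (take the full Kubo matrix of the four terminal forward fields:
symmetry = Onsager reciprocity by momentum reversal, Eckmann–Pillet–Rey-Bellet 1999; PSD = the carré-du-champ
identity `γT Σ_a ‖∂_{p_a} u‖² = ⟨u, −L_dev u⟩` for `u = Σ θ_a gb_a`). v3 replacement of "device NESS existence +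
uniqueness + response" (not needed by the line). -/
theorem stub_kuboFrame :
    ∀ (ω₂ lam β γ T : ℝ), 0 < ω₂ → 0 < lam → 0 < β → 0 < γ → 0 < T →
      ∀ N M : ℕ, 2 ≤ N → 2 ≤ M →
        ∃ (g : Fin 4 → Fin 4 → ℝ) (gb₁ gb₄ : PhaseSpace (N + M) → ℝ),
          KuboFrame (pinnedChain ω₂ lam β γ) T N M g gb₁ gb₄ := by
  sorry

/-- STUB 2a (v4.3) — LOCAL OHM LAW AT THE JUNCTION BOND (size XL; half of THE BET; held by the lead).
`(τ_{N−1} − τ_N)² ≤ C G_L²` for every split, `τ_s = ∫ h (p_s² − T) dμ_T` the first-order kinetic-temperature excess of site `s` in the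
plain chain's linear-response NESS (`h` its density): the one-bond temperature drop at the junction is `O(current)` — an N-uniform
LOWER bound on the conductance of a single interior bond (no interior "temperature jump" larger than `O(J)`), uniformly in the
position of the bond. With STUB 2b it is EQUIVALENT to `∃ θ, v_K(h − θe_K) ≤ C₂G_L²` (v4.2's `stub_junctionRoughnessLTE`) by the landed
exact Hermite split `helper_roughnessSplit` (p121758): `min_θ v_K(h − θe_K) = (τ_{N−1}−τ_N)²/(4T²) + [v_K(h) − (τ²_{N−1}+τ²_N)/(2T²)]`.
A statement about the PLAIN chain only. Directly readable from NEMD temperature profiles. Fails for momentum-conserving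
(superdiffusive) chains; pinning and `lam, β > 0` must enter here. -/
theorem stub_localOhmJunction :
    ∀ (ω₂ lam β γ : ℝ) (μ : (N : ℕ) → ℝ → ℝ → Measure (PhaseSpace N)) (T : ℝ) (D : ℕ → ℝ),
      CruxFrame ω₂ lam β γ μ T D →
      ∃ C : ℝ, ∀ N M : ℕ, 2 ≤ N → 2 ≤ M →
        ∀ (h : PhaseSpace (N + M) → ℝ),
          PlainFrame (pinnedChain ω₂ lam β γ) T (N + M) h (D (N + M) / ((N : ℝ) + (M : ℝ) - 1)) →
          ((∫ x, h x * (kin (N + M) (N - 1) x - T) ∂((pinnedChain ω₂ lam β γ).gibbsMeasure (N + M) T)) -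
              (∫ x, h x * (kin (N + M) N x - T) ∂((pinnedChain ω₂ lam β γ).gibbsMeasure (N + M) T))) ^ 2 ≤
            C * (D (N + M) / ((N : ℝ) + (M : ℝ) - 1)) ^ 2 := by
  sorry

/-- STUB 2b (v4.3) — NON-THERMAL PAIR ROUGHNESS (size XL; the other half of THE BET; held by the lead).
`v_K(h) − (τ²_{N−1} + τ²_N)/(2T²) ≤ C G_L²`: beyond its two first-order kinetic temperatures, the pair's momentum statistics in the
plain chain's linear-response NESS deviate from the Maxwellian by `O(current)` in `L²(μ_T)` (the Bessel remainder of `(I − Π_K)h` after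
projecting on `p²_{N−1} − T`, `p²_N − T`; `≥ 0` by the landed `helper_roughnessBessel`; `≥ G_L²/‖ĵ‖²`-type floor by `helper_roughnessFloor`:
it contains the current mode). A statement about the PLAIN chain only (two-site odd/even-sector local equilibrium at first order). -/
theorem stub_nonThermalPairRoughness :
    ∀ (ω₂ lam β γ : ℝ) (μ : (N : ℕ) → ℝ → ℝ → Measure (PhaseSpace N)) (T : ℝ) (D : ℕ → ℝ),
      CruxFrame ω₂ lam β γ μ T D →
      ∃ C : ℝ, ∀ N M : ℕ, 2 ≤ N → 2 ≤ M →
        ∀ (h : PhaseSpace (N + M) → ℝ),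
          PlainFrame (pinnedChain ω₂ lam β γ) T (N + M) h (D (N + M) / ((N : ℝ) + (M : ℝ) - 1)) →
          roughness (pinnedChain ω₂ lam β γ) T N M h -
              ((∫ x, h x * (kin (N + M) (N - 1) x - T) ∂((pinnedChain ω₂ lam β γ).gibbsMeasure (N + M) T)) ^ 2 +
                (∫ x, h x * (kin (N + M) N x - T) ∂((pinnedChain ω₂ lam β γ).gibbsMeasure (N + M) T)) ^ 2) / (2 * T ^ 2) ≤
            C * (D (N + M) / ((N : ℝ) + (M : ℝ) - 1)) ^ 2 := by
  sorry

/-- v4.2's `stub_junctionRoughnessLTE` (roughness modulo SOME Gibbs shift of the pair), now a THEOREM of STUB 2a + STUB 2b through the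
landed exact Hermite split `helper_roughnessSplit` (choose `θ = (τ_{N−1} + τ_N)/2`); kept under its registered name and signature. -/
theorem stub_junctionRoughnessLTE :
    ∀ (ω₂ lam β γ : ℝ) (μ : (N : ℕ) → ℝ → ℝ → Measure (PhaseSpace N)) (T : ℝ) (D : ℕ → ℝ),
      CruxFrame ω₂ lam β γ μ T D →
      ∃ C₂ : ℝ, ∀ N M : ℕ, 2 ≤ N → 2 ≤ M →
        ∀ (h : PhaseSpace (N + M) → ℝ),
          PlainFrame (pinnedChain ω₂ lam β γ) T (N + M) h (D (N + M) / ((N : ℝ) + (M : ℝ) - 1)) →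
          ∃ θ : ℝ, roughness (pinnedChain ω₂ lam β γ) T N M (fun x => h x - θ * eK T N M x) ≤
            C₂ * (D (N + M) / ((N : ℝ) + (M : ℝ) - 1)) ^ 2 := by
  intro ω₂ lam β γ μ T D hF
  obtain ⟨Ca, hCa⟩ := stub_localOhmJunction ω₂ lam β γ μ T D hF
  obtain ⟨Cb, hCb⟩ := stub_nonThermalPairRoughness ω₂ lam β γ μ T D hF
  obtain ⟨hω, hl, hβ, hγ, -, -, hT, -, -⟩ := id hF
  refine ⟨Ca / (4 * T ^ 2) + Cb, fun N M hN hM h hPF => ?_⟩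
  set τ₁ := ∫ x, h x * (kin (N + M) (N - 1) x - T) ∂((pinnedChain ω₂ lam β γ).gibbsMeasure (N + M) T) with hτ₁
  set τ₂ := ∫ x, h x * (kin (N + M) N x - T) ∂((pinnedChain ω₂ lam β γ).gibbsMeasure (N + M) T) with hτ₂
  refine ⟨(τ₁ + τ₂) / 2, ?_⟩
  have hh : MemLp h 2 ((pinnedChain ω₂ lam β γ).gibbsMeasure (N + M) T) := hPF.1.1
  have hsplit := helper_roughnessSplit ω₂ lam β γ T hω hl.le hβ.le hT N M hN hM h hh ((τ₁ + τ₂) / 2)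
  have ha := hCa N M hN hM h hPF
  have hb := hCb N M hN hM h hPF
  rw [hsplit]
  rw [← hτ₁, ← hτ₂] at ha hb ⊢
  have hT2 : 0 < 4 * T ^ 2 := by positivity
  have e1 : ((τ₁ + τ₂) / 2 - (τ₁ + τ₂) / 2) ^ 2 / T ^ 2 = 0 := by simp
  rw [e1, zero_add]
  have h1 : (τ₁ - τ₂) ^ 2 / (4 * T ^ 2) ≤ Ca / (4 * T ^ 2) * (D (N + M) / ((N : ℝ) + (M : ℝ) - 1)) ^ 2 := by
    rw [div_mul_eq_mul_div, div_le_div_iff_of_pos_right hT2]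
    exact ha
  linarith

/-- STUB 2' (v4.2) — SIGNS OF THE JUNCTION TRANSFERS (pure sign bet; replaces the v3 thermometer).
`u ≥ 0` and `v ≥ 0`, with `u = g₀₁ + g₀₂`, `v = g₁₃ + g₂₃` the junction-pair → end-bath transfer conductances of the device:
heating the two junction thermostats increases the flux into each end bath (DEP-type sign content, NOT implied by the PSD
algebra — `FarTransmission.exists_psd_transfer_neg` — which only gives `u + v ≥ 0`). No bypass clause: the `ρ < 1` margin
`x ≥ −ρ·min(u, v)` that the two-ended elimination needs is a CONSEQUENCE of `stub_junctionCurvature` through the landed energy-channel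
floor `T²u²/γ⁴ ≤ ‖S_K gb₁‖²` (`energyChannel_le_curvature_of_kuboFrame`, p102456): `u ≤ c·a`, `c = γ²√C₃⁺/T`, hence
`x = a − u ≥ −(c/(c+1))·u` (`bypass_lower_of_channel`). -/
theorem stub_transferNonneg :
    ∀ (ω₂ lam β γ T : ℝ), 0 < ω₂ → 0 < lam → 0 < β → 0 < γ → 0 < T →
      ∀ N M : ℕ, 2 ≤ N → 2 ≤ M →
        ∀ (g : Fin 4 → Fin 4 → ℝ) (gb₁ gb₄ : PhaseSpace (N + M) → ℝ),
          KuboFrame (pinnedChain ω₂ lam β γ) T N M g gb₁ gb₄ →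
          0 ≤ transferLeft g ∧ 0 ≤ transferRight g := by
  sorry

/-- STUB 3 — JUNCTION CURVATURE OF THE PROBED FORWARD FIELDS (size L–XL).
`‖S_K gb₁‖² ≤ C₃ L₁₁²` and `‖S_K gb₄‖² ≤ C₃ L₄₄²`: the end-bath forward fields of the DEVICE depend
on the junction momenta at the scale of the device's own self-conductances (energy channel:
`gb₁ ≈ Σ_k w_k (e_k − ⟨e_k⟩)` with `w_K ≈ u/γ²`; direction channel smaller). The two
`p`-derivatives sit at `γ`-noised coordinates of the probed dynamics: unit-time hypoelliptic
smoothing with second-order Malliavin weights at a directly forced coordinate (triage r1-3),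
`N`-uniform because the noise acts on `p_K` itself; Lyapunov weights for the cubic drift. -/
theorem stub_junctionCurvature :
    ∀ (ω₂ lam β γ T : ℝ), 0 < ω₂ → 0 < lam → 0 < β → 0 < γ → 0 < T →
      ∃ C₃ : ℝ, ∀ N M : ℕ, 2 ≤ N → 2 ≤ M →
        ∀ (g : Fin 4 → Fin 4 → ℝ) (gb₁ gb₄ : PhaseSpace (N + M) → ℝ),
          KuboFrame (pinnedChain ω₂ lam β γ) T N M g gb₁ gb₄ →
          curvature (pinnedChain ω₂ lam β γ) T N M gb₁ ≤ C₃ * selfLeft g ^ 2 ∧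
          curvature (pinnedChain ω₂ lam β γ) T N M gb₄ ≤ C₃ * selfRight g ^ 2 := by
  sorry

/-- STUB 4 — TERMINATION LOCALITY, one-sided (size XL; companion card's TL⁺, both ends); v2: the pieces' plain
Kubo frames are supplied as a hypothesis (output of `stub_linearResponsePlain`), giving a Kubo handle on `D N`, `D M`.
`L₁₁ ≤ G_N (1 + c G_N)` and `L₄₄ ≤ G_M (1 + c G_M)`: attaching anything beyond the γ-bathed site
`N−1` (here: the probe on it, the bond, the probed site `N`, `M−1` more sites and a bath, all at
`T`) raises the self-conductance of the far bath by at most `O(G_N²)` — renewal at a bathed site,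
"double escape" (divider ratio `θ_N = O(G_N)`); only this direction is used (Dirichlet side). -/
theorem stub_terminationLocalityTC :
    ∀ (ω₂ lam β γ : ℝ) (μ : (N : ℕ) → ℝ → ℝ → Measure (PhaseSpace N)) (T : ℝ) (D : ℕ → ℝ),
      CruxFrame ω₂ lam β γ μ T D →
      (∀ L : ℕ, 2 ≤ L → ∃ h : PhaseSpace L → ℝ,
          PlainFrame (pinnedChain ω₂ lam β γ) T L h (D L / ((L : ℝ) - 1))) →
      ∃ c : ℝ, ∀ N M : ℕ, 2 ≤ N → 2 ≤ M →
        ∀ (g : Fin 4 → Fin 4 → ℝ) (gb₁ gb₄ : PhaseSpace (N + M) → ℝ),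
          KuboFrame (pinnedChain ω₂ lam β γ) T N M g gb₁ gb₄ →
          selfLeft g ≤ D N / ((N : ℝ) - 1) * (1 + c * (D N / ((N : ℝ) - 1))) ∧
          selfRight g ≤ D M / ((M : ℝ) - 1) * (1 + c * (D M / ((M : ℝ) - 1))) := by
  sorry

/-- STUB 5 — FAR TRANSMISSION, upper bound only (size L–XL; companion card's FT); v2: the sign clause
`0 ≤ bypass g` of v1 is DROPPED (wave-1 verdict stub-misstated: not implied by the PSD form, open DEP-type
positivity, numerically false for a resonant triad between Langevin baths) — the composition no longer needs it
(`FarTransmission.core_estimate_unsigned`); the pieces' plain Kubo frames are supplied as a hypothesis.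
`g₁₄ ≤ c G_N G_M`: energy injected at bath 4 reaches bath 1 past two γ-thermostatted sites
with efficiency `O(G_N G_M)` ("double escape"); upper bound only, uniformly in the split. -/
theorem stub_farTransmission :
    ∀ (ω₂ lam β γ : ℝ) (μ : (N : ℕ) → ℝ → ℝ → Measure (PhaseSpace N)) (T : ℝ) (D : ℕ → ℝ),
      CruxFrame ω₂ lam β γ μ T D →
      (∀ L : ℕ, 2 ≤ L → ∃ h : PhaseSpace L → ℝ,
          PlainFrame (pinnedChain ω₂ lam β γ) T L h (D L / ((L : ℝ) - 1))) →
      ∃ c : ℝ, ∀ N M : ℕ, 2 ≤ N → 2 ≤ M →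
        ∀ (g : Fin 4 → Fin 4 → ℝ) (gb₁ gb₄ : PhaseSpace (N + M) → ℝ),
          KuboFrame (pinnedChain ω₂ lam β γ) T N M g gb₁ gb₄ →
          bypass g ≤ c * (D N / ((N : ℝ) - 1)) * (D M / ((M : ℝ) - 1)) := by
  sorry

/-! ## Composition -/

/-- Cauchy–Schwarz bookkeeping of the α-leg, two-sided: from the squared identity bound and the two size bets to
`|Δ| ≤ γ²√(C₂⁺C₃⁺)·s·G`. -/
theorem insertion_bound_abs {Δ γ cu ro C₃ C₂ s G : ℝ} (hs : 0 ≤ s) (hG : 0 ≤ G)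
    (hro0 : 0 ≤ ro) (h : Δ ^ 2 ≤ γ ^ 4 * cu * ro) (hcu : cu ≤ C₃ * s ^ 2)
    (hro : ro ≤ C₂ * G ^ 2) :
    |Δ| ≤ γ ^ 2 * Real.sqrt (max C₂ 0 * max C₃ 0) * s * G := by
  have hcu' : cu ≤ max C₃ 0 * s ^ 2 :=
    hcu.trans (mul_le_mul_of_nonneg_right (le_max_left _ _) (sq_nonneg _))
  have hro' : ro ≤ max C₂ 0 * G ^ 2 :=
    hro.trans (mul_le_mul_of_nonneg_right (le_max_left _ _) (sq_nonneg _))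
  have hprod : cu * ro ≤ (max C₃ 0 * s ^ 2) * (max C₂ 0 * G ^ 2) :=
    mul_le_mul hcu' hro' hro0 (by positivity)
  have hγ4 : 0 ≤ γ ^ 4 := by positivity
  have hsq : Real.sqrt (max C₂ 0 * max C₃ 0) ^ 2 = max C₂ 0 * max C₃ 0 :=
    Real.sq_sqrt (by positivity)
  have h2 : Δ ^ 2 ≤ (γ ^ 2 * Real.sqrt (max C₂ 0 * max C₃ 0) * s * G) ^ 2 := by
    calc Δ ^ 2 ≤ γ ^ 4 * cu * ro := h
      _ = γ ^ 4 * (cu * ro) := by ring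
      _ ≤ γ ^ 4 * ((max C₃ 0 * s ^ 2) * (max C₂ 0 * G ^ 2)) :=
          mul_le_mul_of_nonneg_left hprod hγ4
      _ = (γ ^ 2 * Real.sqrt (max C₂ 0 * max C₃ 0) * s * G) ^ 2 := by
          rw [show (γ ^ 2 * Real.sqrt (max C₂ 0 * max C₃ 0) * s * G) ^ 2 =
              γ ^ 4 * Real.sqrt (max C₂ 0 * max C₃ 0) ^ 2 * s ^ 2 * G ^ 2 by ring, hsq]
          ring
  have hnn : 0 ≤ γ ^ 2 * Real.sqrt (max C₂ 0 * max C₃ 0) * s * G := by positivity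
  exact abs_le_of_sq_le_sq h2 hnn

/-- `a = u + x`. -/
theorem selfLeft_eq_transfer_add_bypass (g : Fin 4 → Fin 4 → ℝ) :
    selfLeft g = transferLeft g + bypass g := by
  unfold selfLeft transferLeft bypass; ring

/-- `b = v + x`. -/
theorem selfRight_eq_transfer_add_bypass (g : Fin 4 → Fin 4 → ℝ) :
    selfRight g = transferRight g + bypass g := by
  unfold selfRight transferRight bypass; ring

/-- **Bypass margin from the energy channel (pure real algebra; v4.2).** If `0 ≤ u ≤ c·a` (in squared form
`u² ≤ c²a²`, `a, c ≥ 0`) then `x = a − u ≥ −(c/(c+1))·u`: the `ρ < 1` margin of the two-ended elimination with `ρ = c/(c+1)`. -/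
theorem bypass_lower_of_channel {u a c : ℝ} (hu : 0 ≤ u) (ha : 0 ≤ a) (hc : 0 ≤ c) (h : u ^ 2 ≤ c ^ 2 * a ^ 2) :
    -(c / (c + 1) * u) ≤ a - u := by
  have hca : 0 ≤ c * a := mul_nonneg hc ha
  have h' : u ≤ c * a := by
    have : u ^ 2 ≤ (c * a) ^ 2 := by rw [mul_pow]; exact h
    exact (sq_le_sq₀ hu hca).mp this
  have hc1 : 0 < c + 1 := by linarith
  rw [div_mul_eq_mul_div, neg_le, neg_sub, le_div_iff₀ hc1]
  nlinarith

/-- **TWO-ENDED ELIMINATION OF THE PROBE TEMPERATURE (pure real algebra; v4 — replaces the v3 thermometer).**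
The flux functionals are affine in the common probe temperature, `𝒢₁(θ) = x + u(1/2 − θ)`, `𝒢₄(θ) = x + v(1/2 + θ)`,
and agree at the floating temperature, `𝒢₁(θᶠ) = 𝒢₄(θᶠ) = G_dev`; hence EXACTLY
`(u + v)(G_dev − G_L) = v(𝒢₁(θ) − G_L) + u(𝒢₄(θ) − G_L)` for EVERY `θ` (the floating weights kill the `θ`-terms).
So the two-sided identity bounds `|𝒢₁(θ) − G_L| ≤ K a G_L`, `|𝒢₄(θ) − G_L| ≤ K b G_L` at ANY ONE `θ` give
`G_L − G_dev ≤ K G_L (va + ub)/(u+v) ≤ (2/(1−ρ)) K min(a,b) G_L` once `u, v ≥ 0` and `x ≥ −ρ min(u,v)`, `ρ < 1`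
(`va + ub = 2uv + x(u+v)`, `2uv/(u+v) ≤ 2min(u,v)`, `min(a,b) = min(u,v) + x ≥ (1−ρ)min(u,v)`). Degenerate
`u + v = 0`: then `u = v = 0 ≤ x = a = b = G_dev` and the bath-1 bound is the claim. -/
theorem alpha_leg_twoEnded_signs {g : Fin 4 → Fin 4 → ℝ} {θ Gw K ρ : ℝ}
    (hGL : 0 ≤ Gw) (hK : 0 ≤ K) (hρ0 : 0 ≤ ρ) (hρ1 : ρ < 1)
    (hu0 : 0 ≤ transferLeft g) (hv0 : 0 ≤ transferRight g)
    (hdom : -(ρ * min (transferLeft g) (transferRight g)) ≤ bypass g)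
    (h1 : |sideOne g θ - Gw| ≤ K * selfLeft g * Gw)
    (h4 : |sideFour g θ - Gw| ≤ K * selfRight g * Gw) :
    Gw - deviceConductance g ≤ 2 / (1 - ρ) * K * min (selfLeft g) (selfRight g) * Gw := by
  have ha : selfLeft g = transferLeft g + bypass g := selfLeft_eq_transfer_add_bypass g
  have hb : selfRight g = transferRight g + bypass g := selfRight_eq_transfer_add_bypass g
  have e1 : sideOne g θ = bypass g + transferLeft g * (1 / 2 - θ) := rfl
  have e4 : sideFour g θ = bypass g + transferRight g * (1 / 2 + θ) := rfl
  have hρ1' : 0 < 1 - ρ := by linarith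
  have hcoef : 0 ≤ 2 / (1 - ρ) * K := by positivity
  -- generalize the three transfer data
  rw [ha, hb]
  rw [ha] at h1
  rw [hb] at h4
  rw [e1] at h1
  rw [e4] at h4
  have hGd : deviceConductance g = bypass g + transferLeft g * (1 / 2 - floatTemp g) := rfl
  have hfl : floatTemp g = (transferLeft g - transferRight g) / (2 * (transferLeft g + transferRight g)) := rfl
  rw [hGd, hfl]
  generalize transferLeft g = u at *
  generalize transferRight g = v at *
  generalize bypass g = x at *
  -- elementary consequences of the ratio bet
  have hmin0 : 0 ≤ min u v := le_min hu0 hv0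
  have hxlo : -(ρ * min u v) ≤ x := hdom
  have hm : min (u + x) (v + x) = min u v + x := min_add_add_right u v x
  have hm_lo : (1 - ρ) * min u v ≤ min u v + x := by nlinarith only [hxlo]
  have hm0 : 0 ≤ min u v + x := le_trans (by positivity) hm_lo
  rw [hm]
  rcases (add_nonneg hu0 hv0).eq_or_lt with h0 | hpos
  · -- degenerate: u = v = 0, hence x ≥ 0, a = b = x = G_dev, and the bath-1 bound is the claim
    have hu : u = 0 := by linarith [le_antisymm (by linarith : u ≤ 0) hu0]
    have hv : v = 0 := by linarith
    subst hu; subst hv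
    have hx0 : 0 ≤ x := by simpa using hdom
    have h1' : Gw - x ≤ K * x * Gw := by
      have : |x + 0 * (1 / 2 - θ) - Gw| ≤ K * (0 + x) * Gw := h1
      simp only [zero_mul, add_zero, zero_add] at this
      linarith [neg_abs_le (x - Gw), abs_sub_comm x Gw, le_abs_self (Gw - x)]
    have hKx : 0 ≤ K * x * Gw := by positivity
    have hcoef1 : 1 ≤ 2 / (1 - ρ) := by rw [le_div_iff₀ hρ1']; linarith
    simp only [min_self, zero_add, zero_mul, sub_zero, add_zero, zero_div, mul_zero]
    nlinarith only [h1', hKx, hcoef1]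
  · -- main case
    have hne : u + v ≠ 0 := ne_of_gt hpos
    -- (u+v) G_dev = (u+v) x + u v
    have hGd' : (u + v) * (x + u * (1 / 2 - (u - v) / (2 * (u + v)))) = (u + v) * x + u * v := by
      field_simp
      ring
    -- exact elimination: (u+v)(Gw − G_dev) = −(v E₁ + u E₄)
    have helim : (u + v) * (Gw - (x + u * (1 / 2 - (u - v) / (2 * (u + v))))) =
        -(v * (x + u * (1 / 2 - θ) - Gw) + u * (x + v * (1 / 2 + θ) - Gw)) := by
      have : (u + v) * (Gw - (x + u * (1 / 2 - (u - v) / (2 * (u + v))))) =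
          (u + v) * Gw - ((u + v) * x + u * v) := by rw [← hGd']; ring
      rw [this]; ring
    -- two-sided bounds
    have hE1' : -(x + u * (1 / 2 - θ) - Gw) ≤ K * (u + x) * Gw :=
      le_trans (neg_le_abs _) h1
    have hE4' : -(x + v * (1 / 2 + θ) - Gw) ≤ K * (v + x) * Gw :=
      le_trans (neg_le_abs _) h4
    have hE1 := mul_le_mul_of_nonneg_left hE1' hv0
    have hE4 := mul_le_mul_of_nonneg_left hE4' hu0
    have hsum : (u + v) * (Gw - (x + u * (1 / 2 - (u - v) / (2 * (u + v))))) ≤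
        K * Gw * (2 * (u * v) + x * (u + v)) := by
      rw [helim]
      have e : v * (K * (u + x) * Gw) + u * (K * (v + x) * Gw) = K * Gw * (2 * (u * v) + x * (u + v)) := by
        ring
      have e1 : v * -(x + u * (1 / 2 - θ) - Gw) = -(v * (x + u * (1 / 2 - θ) - Gw)) := by ring
      have e4 : u * -(x + v * (1 / 2 + θ) - Gw) = -(u * (x + v * (1 / 2 + θ) - Gw)) := by ring
      linarith only [hE1, hE4, e, e1, e4]
    -- 2uv ≤ 2 min(u,v) (u+v) and 2 min + x ≤ (2/(1−ρ)) (min + x)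
    have huv : 2 * (u * v) ≤ 2 * min u v * (u + v) := by
      rcases le_total u v with huv | hvu
      · rw [min_eq_left huv]; nlinarith only [mul_nonneg hu0 hu0, huv, hu0]
      · rw [min_eq_right hvu]; nlinarith only [mul_nonneg hv0 hv0, hvu, hv0]
    have h2 : 2 * min u v + x ≤ 2 / (1 - ρ) * (min u v + x) := by
      rw [div_mul_eq_mul_div, le_div_iff₀ hρ1']
      have hx1 := mul_le_mul_of_nonneg_left hxlo (by linarith : (0 : ℝ) ≤ 1 + ρ)
      have hnn : 0 ≤ ρ * (1 - ρ) * min u v := mul_nonneg (mul_nonneg hρ0 hρ1'.le) hmin0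
      nlinarith only [hx1, hnn]
    have h3 := mul_le_mul_of_nonneg_left h2 hpos.le
    have hkey : 2 * (u * v) + x * (u + v) ≤ (u + v) * (2 / (1 - ρ) * (min u v + x)) := by
      have e : (u + v) * (2 * min u v + x) = 2 * min u v * (u + v) + x * (u + v) := by ring
      linarith only [huv, h3, e]
    have hfin : (u + v) * (Gw - (x + u * (1 / 2 - (u - v) / (2 * (u + v))))) ≤
        (u + v) * (2 / (1 - ρ) * K * (min u v + x) * Gw) := by
      have hKGL : 0 ≤ K * Gw := mul_nonneg hK hGL
      have step := mul_le_mul_of_nonneg_left hkey hKGL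
      have e : K * Gw * ((u + v) * (2 / (1 - ρ) * (min u v + x))) =
          (u + v) * (2 / (1 - ρ) * K * (min u v + x) * Gw) := by ring
      linarith only [hsum, step, e]
    exact le_of_mul_le_mul_left hfin hpos

/-- COMPOSITION (v4; kernel-checked; the only `sorry`s it depends on are the six registered stubs, used BY NAME):
the crux `JunctionLocality.SuperadditiveResistance` BY NAME, for all `N, M ≥ 2`, with the constant
`C = 4c + 4K' + 4K'(1+c) + 2`, `K' = (2/(1−ρ))·γ²√(C₂⁺C₃⁺)`, `c = max(c_TL, c_FT, 0)`. Logical shape: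
`stub_linearResponsePlain (closed) → stub_kuboFrame → insertionIdentity_of_kuboFrame (closed) → stub_junctionRoughnessLTE
→ stub_junctionCurvature → stub_transferNonneg → alpha_leg_twoEnded_signs → stub_terminationLocalityTC → stub_farTransmission
→ core_estimate_unsigned → SuperadditiveResistance`. -/
theorem SuperadditiveResistance_of :
    Summit.AtomisticToContinuum.FouriersLaw.Theses.JunctionLocality.SuperadditiveResistance := by
  have hLRp := stub_linearResponsePlain
  have hLRd := stub_kuboFrame
  have hID := insertionIdentity_of_kuboFrame
  have hRO := stub_junctionRoughnessLTE
  have hCU := stub_junctionCurvature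
  have hBD := stub_transferNonneg
  have hTL := stub_terminationLocalityTC
  have hFT := stub_farTransmission
  intro ω₂ lam β γ hω hl hβ hγ hU μ hμ T hT D hD hpos
  have hF : CruxFrame ω₂ lam β γ μ T D := ⟨hω, hl, hβ, hγ, hU, hμ, hT, hD, hpos⟩
  have hPlain := hLRp ω₂ lam β γ μ T D hF
  have hDev := hLRd ω₂ lam β γ T hω hl hβ hγ hT
  obtain ⟨C₂, hC₂⟩ := hRO ω₂ lam β γ μ T D hF
  obtain ⟨C₃, hC₃⟩ := hCU ω₂ lam β γ T hω hl hβ hγ hT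
  have hρ := hBD ω₂ lam β γ T hω hl hβ hγ hT
  obtain ⟨c₁, hc₁⟩ := hTL ω₂ lam β γ μ T D hF hPlain
  obtain ⟨c₂, hc₂⟩ := hFT ω₂ lam β γ μ T D hF hPlain
  -- uniform constants
  obtain ⟨c, hc_def⟩ : ∃ c : ℝ, c = max (max c₁ c₂) 0 := ⟨_, rfl⟩
  obtain ⟨K, hK_def⟩ : ∃ K : ℝ, K = γ ^ 2 * Real.sqrt (max C₂ 0 * max C₃ 0) := ⟨_, rfl⟩
  -- the bypass margin ρ = c₀/(c₀+1), c₀ = γ²√C₃⁺/T, from the energy-channel floor of the curvature bet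
  obtain ⟨c₀, hc₀_def⟩ : ∃ c₀ : ℝ, c₀ = γ ^ 2 * Real.sqrt (max C₃ 0) / T := ⟨_, rfl⟩
  have hc₀ : 0 ≤ c₀ := by rw [hc₀_def]; positivity
  obtain ⟨ρ, hρ_def⟩ : ∃ ρ : ℝ, ρ = c₀ / (c₀ + 1) := ⟨_, rfl⟩
  have hρ0 : 0 ≤ ρ := by rw [hρ_def]; positivity
  have hρ1 : ρ < 1 := by rw [hρ_def, div_lt_one (by linarith)]; linarith
  obtain ⟨K', hK'_def⟩ : ∃ K' : ℝ, K' = 2 / (1 - ρ) * K := ⟨_, rfl⟩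
  have hc0 : 0 ≤ c := by rw [hc_def]; exact le_max_right _ _
  have hcc₁ : c₁ ≤ c := by rw [hc_def]; exact le_trans (le_max_left _ _) (le_max_left _ _)
  have hcc₂ : c₂ ≤ c := by rw [hc_def]; exact le_trans (le_max_right _ _) (le_max_left _ _)
  have hK0 : 0 ≤ K := by rw [hK_def]; positivity
  have hρ1' : 0 < 1 - ρ := by linarith
  have hK'0 : 0 ≤ K' := by rw [hK'_def]; positivity
  refine ⟨4 * c + 4 * K' + 4 * K' * (1 + c) + 2, ?_⟩
  intro N M hN hM
  -- the response field of the whole chain and the device data of this split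
  obtain ⟨h, hPF⟩ := hPlain (N + M) (by omega)
  obtain ⟨g, gb₁, gb₄, hDF⟩ := hDev N M hN hM
  have hcast : ((N + M : ℕ) : ℝ) - 1 = (N : ℝ) + (M : ℝ) - 1 := by push_cast; ring
  rw [hcast] at hPF
  -- conductances of the whole and of the pieces
  obtain ⟨gL, hgL⟩ : ∃ gL : ℝ, gL = D (N + M) / ((N : ℝ) + (M : ℝ) - 1) := ⟨_, rfl⟩
  obtain ⟨gN, hgN⟩ : ∃ gN : ℝ, gN = D N / ((N : ℝ) - 1) := ⟨_, rfl⟩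
  obtain ⟨gM, hgM⟩ : ∃ gM : ℝ, gM = D M / ((M : ℝ) - 1) := ⟨_, rfl⟩
  have hN' : (2 : ℝ) ≤ (N : ℝ) := by exact_mod_cast hN
  have hM' : (2 : ℝ) ≤ (M : ℝ) := by exact_mod_cast hM
  have hgN0 : 0 < gN := by rw [hgN]; exact div_pos (hpos N hN) (by linarith)
  have hgM0 : 0 < gM := by rw [hgM]; exact div_pos (hpos M hM) (by linarith)
  have hgL0 : 0 < gL := by rw [hgL]; exact div_pos (hpos (N + M) (by omega)) (by linarith)
  -- the roughness bet picks the Gibbs shift θ₀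
  obtain ⟨θ₀, hrough⟩ := hC₂ N M hN hM h hPF
  rw [← hgL] at hPF hrough
  have hsym : ∀ a b, g a b = g b a := hDF.1
  have hpsd : ∀ θ, 0 ≤ dirichletForm g θ := hDF.2.1
  have ha0 : 0 ≤ selfLeft g := selfLeft_nonneg hsym hpsd
  have hb0 : 0 ≤ selfRight g := selfRight_nonneg hsym hpsd
  -- α-LEG: the identity at θ₀, from both ends, with the two size bets, then the two-ended elimination
  obtain ⟨h1, h4⟩ := hID ω₂ lam β γ T hω hl hβ hγ hT N M hN hM h gL g gb₁ gb₄ hPF hDF θ₀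
  obtain ⟨hcurv₁, hcurv₄⟩ := hC₃ N M hN hM g gb₁ gb₄ hDF
  have hro0 : 0 ≤ roughness (pinnedChain ω₂ lam β γ) T N M (fun x => h x - θ₀ * eK T N M x) :=
    integral_nonneg fun _ => sq_nonneg _
  have hα₁ : |sideOne g θ₀ - gL| ≤ K * selfLeft g * gL := by
    rw [hK_def]; exact insertion_bound_abs ha0 hgL0.le hro0 h1 hcurv₁ hrough
  have hα₄ : |sideFour g θ₀ - gL| ≤ K * selfRight g * gL := by
    rw [hK_def]; exact insertion_bound_abs hb0 hgL0.le hro0 h4 hcurv₄ hrough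
  obtain ⟨hu0, hv0⟩ := hρ N M hN hM g gb₁ gb₄ hDF
  -- the ρ-margin of the bypass from the curvature bet through the landed energy-channel floor
  obtain ⟨hfl₁, hfl₄⟩ := energyChannel_le_curvature_of_kuboFrame hω hl.le hβ.le hγ hT (by omega) (by omega) hDF
  have hsq : Real.sqrt (max C₃ 0) ^ 2 = max C₃ 0 := Real.sq_sqrt (le_max_right _ _)
  have hC₃le : C₃ ≤ max C₃ 0 := le_max_left _ _
  have hT2 : 0 < T ^ 2 := by positivity
  have hγ4 : 0 < γ ^ 4 := by positivity
  have hch₁ : transferLeft g ^ 2 ≤ c₀ ^ 2 * selfLeft g ^ 2 := by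
    have h1 : T ^ 2 * transferLeft g ^ 2 / γ ^ 4 ≤ max C₃ 0 * selfLeft g ^ 2 :=
      hfl₁.trans (hcurv₁.trans (mul_le_mul_of_nonneg_right hC₃le (sq_nonneg _)))
    have e : c₀ ^ 2 * selfLeft g ^ 2 = γ ^ 4 / T ^ 2 * (max C₃ 0 * selfLeft g ^ 2) := by
      rw [hc₀_def, div_pow, mul_pow, hsq]; ring
    have h2 := mul_le_mul_of_nonneg_left h1 (le_of_lt (by positivity : (0:ℝ) < γ ^ 4 / T ^ 2))
    have e2 : γ ^ 4 / T ^ 2 * (T ^ 2 * transferLeft g ^ 2 / γ ^ 4) = transferLeft g ^ 2 := by field_simp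
    rw [e2] at h2; rw [e]; exact h2
  have hch₄ : transferRight g ^ 2 ≤ c₀ ^ 2 * selfRight g ^ 2 := by
    have h4 : T ^ 2 * transferRight g ^ 2 / γ ^ 4 ≤ max C₃ 0 * selfRight g ^ 2 :=
      hfl₄.trans (hcurv₄.trans (mul_le_mul_of_nonneg_right hC₃le (sq_nonneg _)))
    have e : c₀ ^ 2 * selfRight g ^ 2 = γ ^ 4 / T ^ 2 * (max C₃ 0 * selfRight g ^ 2) := by
      rw [hc₀_def, div_pow, mul_pow, hsq]; ring
    have h5 := mul_le_mul_of_nonneg_left h4 (le_of_lt (by positivity : (0:ℝ) < γ ^ 4 / T ^ 2))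
    have e2 : γ ^ 4 / T ^ 2 * (T ^ 2 * transferRight g ^ 2 / γ ^ 4) = transferRight g ^ 2 := by field_simp
    rw [e2] at h5; rw [e]; exact h5
  have hxu : -(ρ * transferLeft g) ≤ bypass g := by
    have := bypass_lower_of_channel hu0 ha0 hc₀ hch₁
    rw [selfLeft_eq_transfer_add_bypass] at this
    rw [hρ_def]; linarith
  have hxv : -(ρ * transferRight g) ≤ bypass g := by
    have := bypass_lower_of_channel hv0 hb0 hc₀ hch₄
    rw [selfRight_eq_transfer_add_bypass] at this
    rw [hρ_def]; linarith
  have hdom : -(ρ * min (transferLeft g) (transferRight g)) ≤ bypass g := by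
    rcases le_total (transferLeft g) (transferRight g) with huv | hvu
    · rw [min_eq_left huv]; exact hxu
    · rw [min_eq_right hvu]; exact hxv
  have hα : gL - deviceConductance g ≤ K' * min (selfLeft g) (selfRight g) * gL := by
    rw [hK'_def]
    exact alpha_leg_twoEnded_signs hgL0.le hK0 hρ0 hρ1 hu0 hv0 hdom hα₁ hα₄
  -- β-LEG: the Dirichlet principle and the one-sided termination/transmission bets
  have hDir := deviceConductance_le hsym hpsd
  obtain ⟨hTLa, hTLb⟩ := hc₁ N M hN hM g gb₁ gb₄ hDF
  have hxup := hc₂ N M hN hM g gb₁ gb₄ hDF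
  rw [← hgN] at hTLa hxup
  rw [← hgM] at hTLb hxup
  have ha : selfLeft g ≤ gN * (1 + c * gN) :=
    hTLa.trans (mul_le_mul_of_nonneg_left
      ((add_le_add_iff_left 1).mpr (mul_le_mul_of_nonneg_right hcc₁ hgN0.le)) hgN0.le)
  have hb : selfRight g ≤ gM * (1 + c * gM) :=
    hTLb.trans (mul_le_mul_of_nonneg_left
      ((add_le_add_iff_left 1).mpr (mul_le_mul_of_nonneg_right hcc₁ hgM0.le)) hgM0.le)
  have hx : bypass g ≤ c * gN * gM :=
    hxup.trans (mul_le_mul_of_nonneg_right (mul_le_mul_of_nonneg_right hcc₂ hgN0.le) hgM0.le)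
  -- the real-analysis core
  have key := FarTransmission.core_estimate_unsigned' hgN0 hgM0 hgL0 hK'0 hc0 ha hb hx hα hDir
  rw [hgN, hgM, hgL, one_div_div, one_div_div, one_div_div] at key
  exact key

end Summit.AtomisticToContinuum.FouriersLaw.Cruxes.SuperadditiveResistance.ThermaliseThenCutProbeInsertion

end
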